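import Summits.QuantumFields.BalabanUV.Beta.FP.RoadEndGeneric
import Summits.QuantumFields.BalabanUV.Beta.FP.PerfectJetsTranslate
import Summits.QuantumFields.BalabanUV.Beta.FP.PerfectKernelSymmOne
import Summits.QuantumFields.BalabanUV.Beta.FP.SymmetryK

/-!
# `BalabanUV.Beta.FP.PerfectKernelSymmGeneric` — road «FP» for binder row D1, row TGEN-SWAP (owner ruling R-FP-13 (d)): THE TRANSPOSITION SYMMETRY
# `hTsymm` OF THE GENERIC (FOUR-SLOT) PERFECT ONE-STEP KERNEL from coarse invariance of the resolvent slots, (St♭) of the stencils, (Wt) + bond-swap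
# symmetry of the tables — all INHERITED from finite-`j` SHAPE data of ANY supplied families; block-mean rooted instance

HONEST FRAMING (cell contract, verbatim): «discharging `BetaPertH` makes Bałaban's UV stability UNCONDITIONAL — a real constructive-QFT
result; it is NOT the continuum limit and NOT the Clay problem.»  THIS MODULE DISCHARGES NOTHING of D1 / BetaPertH: it is leaf-02-g4's generic
`PerfectKernelSymm.hessKer_swap` instantiated at `RoadEndGeneric.TGenOf n A K S W := hessKer A (vertexOfK K n S) W`, plus the passage of the four
finite-`j` shape data (coarse invariance of the A- and K-families, (St♭) of the stencil family, (Wt) and bond-swap symmetry of the table family)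
to the constructed limits (`SymmetryK.shiftK_limMKerOf_of_invariant`, `translate_limStOf`/`translate_limTabOf`, `PerfectKernelSymmOne.symm_limTabOf` —
entrywise, unconditional).  RESULT: the binder `hTsymm` of `StepLawWardGeneric.d1Drift_of_generic_ward_symm_explicitDefect` ⟸ {class data of the
perfect `m = 1` objects (decay / localisation — the same data the END already asks), the four finite-`j` SHAPE rows}; for the block-mean rooted family
the K-shape row is an2's tree theorem `AxialDressingRootedBmHessian.shiftK_coDressKBmAt_KInvStep`, so `hTsymm` ⟸ {class data, (St♭)/(Wt)/swap of the
UNDRESSED jets}.  Skeleton `HOME/beta/skeletons/D1-b2b-balaban-beta-d1-p3.md`; claim table `LEAVES-FP.md` row TGEN-SWAP.  NOT «D1 closed»,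
NOT BetaPertH, NOT continuum, NOT Clay.
ABSOLUTE RULE (cell, verbatim): «No internally-minted statement may enter as a cited fact. Every hypothesis is either kernel-proved in this
package or a verbatim quotation of a PUBLISHED theorem with page reference.»  Nothing cited; no `def … : Prop`; no binder instantiated at a value.
HONEST DEPENDENCY (verbatim): «continuum YM on T⁴ ⇐ BetaPertH ∧ nine spine estimates (0/9 proved); BetaPertH ⇐ (D1) ∧ (D4) ∧ CAP+tail;
G-an2-4 gates asym, D1 and NE2/3/4.»

CONTENT.
* §1 **`TGenOf_swap`** — `TGenOf n A K S W a b t = TGenOf n A K S W b a (−t)` (any `n`) ⟸ decaying coarse-invariant `A`, decaying coarse-invariant `K`,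
  local coarse-covariant `S`, coarse-covariant bond-swap-symmetric `W` (`hessKer_swap` + `BalabanStepJetsSucc.vertexOfK_translate_block`).
* §2 limit suppliers: `shiftK_KPerfOf_one` (coarse invariance of `KPerfOf … 1` from that of every `m = 1` member, any units), `SPerfOf_one_translate_of`
  ((St♭) of `SPerfOf … 1` from that of every member), and **`hTsymm_TGenOf_one`**: the END's binder `hTsymm` ⟸ {decay of `KPerfOf … A 1`/`KPerfOf … G 1`,
  localisation of `SPerfOf … 1`, the four finite-`j` shape rows}.
* §3 **`hTsymm_TGenOf_one_dressBmAt`** — block-mean rooted instance: K-shape row discharged (`shiftK_coDressKBmAt_KInvStep`).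
Provenance: road FP owner b2b-balaban-beta-d1-p3 gen 3, 2026-08-20; over leaf-02-g4 `PerfectKernelSymm`/`PerfectKernelSymmOne`, leaf-06-g2 `SymmetryK`,
an2 `AxialDressingRootedBmHessian` BY NAME.  [our object], 0 `def`, 0 cite, 0 sorry.
-/

noncomputable section

namespace Summit.QuantumFields.BalabanUV.Beta.FP.PerfectKernelSymmGeneric

open Literature.MathematicalPhysics.QuantumFieldTheory.Balaban1983to89
open Literature.MathematicalPhysics.QuantumFieldTheory.Balaban1983to89.Beta
open ExpKernelCalculus (Site MKer Decays BiLoc VertexFamily hessKer shiftK)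
open OneStepResolventKernel (Fib LocStencil JetData)
open OneStepKernelFamily (vertexOfK KInvStep vertexFamily_vertexOfK')
open AffineAveraging (box toSite)
open BalabanStepJetsSucc (vertexOfK_translate_block)
open HessKerDressedLimit (limMKerOf limStOf limTabOf)
open Summit.QuantumFields.BalabanUV.Beta.TameKernelCalculus (decays_of_le biLoc_of_le)
open Summit.QuantumFields.BalabanUV.Beta.HessKerDressedUnits (unitK unitS unitW)
open Summit.QuantumFields.BalabanUV.Beta.AxialDressingRooted (dressBmAt coDressKBmAt shiftK_coDressKBmAt_KInvStep)
open Summit.QuantumFields.BalabanUV.Beta.FP.PerfectObjectsT (SPerfOf WPerfOf SPerfOf_one)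
open Summit.QuantumFields.BalabanUV.Beta.FP.PerfectKernelSymm (hessKer_swap)
open Summit.QuantumFields.BalabanUV.Beta.FP.PerfectKernelSymmOne (WPerfOf_one_symm)
open Summit.QuantumFields.BalabanUV.Beta.FP.PerfectJetsTranslate (WPerfOf_one_translate)
open Summit.QuantumFields.BalabanUV.Beta.FP.SymmetryK (shiftK_unitK shiftK_limMKerOf_of_invariant translate_limStOf unitS_translate)
open Summit.QuantumFields.BalabanUV.Beta.FP.RoadEndGeneric (KPerfOf KPerfOf_one TGenOf)

/-! ## §1 The four-slot kernel is symmetric under `(a, t) ↔ (b, −t)` -/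

/-- [our object] **TRANSPOSITION SYMMETRY OF THE FOUR-SLOT KERNEL** (`1 ≤ n`): A-slot decaying and coarse-invariant, K-slot decaying and coarse-invariant,
stencils local and coarse-covariant ((St♭)), tables coarse-covariant ((Wt)) and bond-swap symmetric ⟹ `TGenOf n A K S W a b t = TGenOf n A K S W b a (−t)`
(any blocking `n`). -/
theorem TGenOf_swap {n : ℕ} {A K : MKer (3 + 1) (Fib 3)} {CA δA : ℝ} (hA : Decays A CA δA) (hδA : 0 < δA)
    (hAcov : ∀ t : Fin (3 + 1) → ℤ, shiftK (-((n : ℤ) • t)) A = A)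
    (hK : ∃ δ C : ℝ, 0 < δ ∧ 0 ≤ C ∧ Decays K C δ) (hKcov : ∀ t : Fin (3 + 1) → ℤ, shiftK (-((n : ℤ) • t)) K = K)
    {S : Fin (3 + 1) → (Fin (3 + 1) → ℤ) → MKer (3 + 1) (Fib 3)} {Cs δs : ℝ} (hS : LocStencil S Cs δs) (hδs : 0 < δs)
    (hScov : ∀ (κ : Fin (3 + 1)) (u t : Fin (3 + 1) → ℤ), S κ (u + (n : ℤ) • t) = shiftK (-((n : ℤ) • t)) (S κ u))
    {W : Fin (3 + 1) → (Fin (3 + 1) → ℤ) → Fin (3 + 1) → (Fin (3 + 1) → ℤ) → MKer (3 + 1) (Fib 3)}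
    (hWcov : ∀ (μ : Fin (3 + 1)) (y : Fin (3 + 1) → ℤ) (ν : Fin (3 + 1)) (y' t : Fin (3 + 1) → ℤ),
      W μ (y + t) ν (y' + t) = shiftK (-((n : ℤ) • t)) (W μ y ν y'))
    (hWsymm : ∀ (μ : Fin (3 + 1)) (y : Fin (3 + 1) → ℤ) (ν : Fin (3 + 1)) (y' : Fin (3 + 1) → ℤ), W μ y ν y' = W ν y' μ y)
    (a b : Fin (3 + 1)) (t : Fin (3 + 1) → ℤ) :
    TGenOf n A K S W a b t = TGenOf n A K S W b a (-t) := by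
  obtain ⟨Cv, δv, hδv, hV⟩ := vertexFamily_vertexOfK' (N := n) hK hS hδs
  have hm : 0 < min δA δv := lt_min hδA hδv
  have hA' := decays_of_le hA (min_le_left δA δv)
  have hV' : VertexFamily (vertexOfK K n S) n (|Cv|) (min δA δv) := fun μ y => biLoc_of_le (hV μ y) (min_le_right _ _)
  have hVcov : ∀ (μ : Fin (3 + 1)) (y s : Fin (3 + 1) → ℤ), vertexOfK K n S μ (y + s) = shiftK (-((n : ℤ) • s)) (vertexOfK K n S μ y) :=
    fun μ y s => vertexOfK_translate_block hKcov hScov μ y s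
  exact hessKer_swap hA' hm hAcov hV' hVcov hWcov hWsymm a b t

/-! ## §2 The shape rows pass to the perfect `m = 1` objects; the END's binder `hTsymm` -/

section Limit

variable {d : ℕ}

/-- [our object] **COARSE INVARIANCE OF `KPerfOf … 1`** from that of every `m = 1` member (any units; entrywise, unconditional). -/
theorem shiftK_KPerfOf_one (sf sm : ℕ → ℝ) {G : ℕ → ℕ → MKer (d + 1) (Fib d)} {G1 : ℕ → MKer (d + 1) (Fib d)} (hG1 : ∀ j, G j 1 = G1 j)
    {n : ℕ} (hGcov : ∀ (j : ℕ) (t : Fin (d + 1) → ℤ), shiftK (-((n : ℤ) • t)) (G1 j) = G1 j) (t : Fin (d + 1) → ℤ) :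
    shiftK (-((n : ℤ) • t)) (KPerfOf sf sm G 1) = KPerfOf sf sm G 1 := by
  rw [KPerfOf_one sf sm hG1]
  exact shiftK_limMKerOf_of_invariant fun j => by rw [shiftK_unitK, hGcov j t]

/-- [our object] **(St♭) OF `SPerfOf … 1`** from that of every `m = 1` member (any units; entrywise, unconditional). -/
theorem SPerfOf_one_translate_of (sf sm : ℕ → ℝ) {S : ℕ → ℕ → Fin (d + 1) → (Fin (d + 1) → ℤ) → MKer (d + 1) (Fib d)}
    {S1 : ℕ → Fin (d + 1) → (Fin (d + 1) → ℤ) → MKer (d + 1) (Fib d)} (hS1 : ∀ j, S j 1 = S1 j) {n : ℕ}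
    (hSt : ∀ (j : ℕ) (κ : Fin (d + 1)) (u t : Fin (d + 1) → ℤ), S1 j κ (u + (n : ℤ) • t) = shiftK (-((n : ℤ) • t)) (S1 j κ u))
    (κ : Fin (d + 1)) (u t : Fin (d + 1) → ℤ) :
    SPerfOf sf sm S 1 κ (u + (n : ℤ) • t) = shiftK (-((n : ℤ) • t)) (SPerfOf sf sm S 1 κ u) := by
  rw [SPerfOf_one sf sm hS1]
  exact translate_limStOf (S := fun j => unitS (sf j) (sm j) (S1 j)) (fun j κ' u' => unitS_translate (fun κ₀ u₀ => hSt j κ₀ u₀ t) (sf j) (sm j) κ' u') κ u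

end Limit

section Perfect

variable {Lc : ℕ} (sf sm : ℕ → ℝ) (A G : ℕ → ℕ → MKer (3 + 1) (Fib 3))
  (S : ℕ → ℕ → Fin (3 + 1) → (Fin (3 + 1) → ℤ) → MKer (3 + 1) (Fib 3))
  (Wt : ℕ → ℕ → Fin (3 + 1) → (Fin (3 + 1) → ℤ) → Fin (3 + 1) → (Fin (3 + 1) → ℤ) → MKer (3 + 1) (Fib 3))
  {A1 G1 : ℕ → MKer (3 + 1) (Fib 3)} {S1 : ℕ → Fin (3 + 1) → (Fin (3 + 1) → ℤ) → MKer (3 + 1) (Fib 3)}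
  {W1 : ℕ → Fin (3 + 1) → (Fin (3 + 1) → ℤ) → Fin (3 + 1) → (Fin (3 + 1) → ℤ) → MKer (3 + 1) (Fib 3)}

/-- [our object] **THE END's BINDER `hTsymm` FOR THE GENERIC PERFECT ONE-STEP KERNEL** (any `Lc`, any families, any units):
`TGenOf Lc (KPerfOf … A 1) (KPerfOf … G 1) (SPerfOf … 1) (WPerfOf … 1) a b t = (same) b a (−t)` ⟸ {decay of the two perfect resolvents, localisation of the
perfect stencil (class data), and four FINITE-`j` SHAPE rows: coarse invariance of every `A1 j` and `G1 j`, (St♭) of every `S1 j`, (Wt) and bond-swap symmetry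
of every `W1 j`}. -/
theorem hTsymm_TGenOf_one
    (hA1 : ∀ j, A j 1 = A1 j) (hG1 : ∀ j, G j 1 = G1 j) (hS1 : ∀ j, S j 1 = S1 j) (hW1 : ∀ j, Wt j 1 = W1 j)
    {CA δA : ℝ} (hAinf : Decays (KPerfOf (d := 3) sf sm A 1) CA δA) (hδA : 0 < δA)
    (hGinf : ∃ δ C : ℝ, 0 < δ ∧ 0 ≤ C ∧ Decays (KPerfOf (d := 3) sf sm G 1) C δ)
    {Cs δs : ℝ} (hSinf : LocStencil (SPerfOf sf sm S 1) Cs δs) (hδs : 0 < δs)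
    (hAcov : ∀ (j : ℕ) (t : Fin (3 + 1) → ℤ), shiftK (-((Lc : ℤ) • t)) (A1 j) = A1 j)
    (hGcov : ∀ (j : ℕ) (t : Fin (3 + 1) → ℤ), shiftK (-((Lc : ℤ) • t)) (G1 j) = G1 j)
    (hSt : ∀ (j : ℕ) (κ : Fin (3 + 1)) (u t : Fin (3 + 1) → ℤ), S1 j κ (u + (Lc : ℤ) • t) = shiftK (-((Lc : ℤ) • t)) (S1 j κ u))
    (hWt : ∀ (j : ℕ) (μ : Fin (3 + 1)) (y : Fin (3 + 1) → ℤ) (ν : Fin (3 + 1)) (y' t : Fin (3 + 1) → ℤ),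
      W1 j μ (y + t) ν (y' + t) = shiftK (-((Lc : ℤ) • t)) (W1 j μ y ν y'))
    (hWsymm : ∀ (j : ℕ) (μ : Fin (3 + 1)) (y : Fin (3 + 1) → ℤ) (ν : Fin (3 + 1)) (y' : Fin (3 + 1) → ℤ), W1 j μ y ν y' = W1 j ν y' μ y)
    (a b : Fin (3 + 1)) (t : Fin (3 + 1) → ℤ) :
    TGenOf Lc (KPerfOf sf sm A 1) (KPerfOf sf sm G 1) (SPerfOf sf sm S 1) (WPerfOf sf sm Wt 1) a b t
      = TGenOf Lc (KPerfOf sf sm A 1) (KPerfOf sf sm G 1) (SPerfOf sf sm S 1) (WPerfOf sf sm Wt 1) b a (-t) :=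
  TGenOf_swap hAinf hδA (shiftK_KPerfOf_one sf sm hA1 hAcov) hGinf (shiftK_KPerfOf_one sf sm hG1 hGcov) hSinf hδs
    (SPerfOf_one_translate_of sf sm hS1 hSt) (WPerfOf_one_translate W1 sf sm Wt hWt hW1) (WPerfOf_one_symm W1 Wt sf sm hWsymm hW1) a b t

end Perfect

/-! ## §3 The block-mean rooted instance: the K-shape row is a tree theorem -/

section BlockMean

variable {Lc : ℕ} [NeZero Lc] {r : Fin 4 → ℕ} (Js0 : ℕ → JetData 3 Lc) (sf sm : ℕ → ℝ)
  (G : ℕ → ℕ → MKer (3 + 1) (Fib 3)) (S : ℕ → ℕ → Fin (3 + 1) → (Fin (3 + 1) → ℤ) → MKer (3 + 1) (Fib 3))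
  (Wt : ℕ → ℕ → Fin (3 + 1) → (Fin (3 + 1) → ℤ) → Fin (3 + 1) → (Fin (3 + 1) → ℤ) → MKer (3 + 1) (Fib 3))

/-- [our object] **`hTsymm` FOR THE BLOCK-MEAN ROOTED PERFECT ONE-STEP KERNEL** (`m = 1` members `(coDressKBmAt (toSite r) Lc (KInvStep Lc j), (Js⁰ j).S, (Js⁰ j).W)`):
⟸ {decay of `KPerfOf … G 1`, localisation of `SPerfOf … 1` (class data), (St♭) ∕ (Wt) ∕ bond-swap symmetry of the UNDRESSED jets at every `j`} — coarse
invariance of the co-dressed resolvents is an2's `shiftK_coDressKBmAt_KInvStep`.  Plugs into `StepLawWardGeneric.d1Drift_dressBmAt_of_ward_symm_explicitDefect`. -/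
theorem hTsymm_TGenOf_one_dressBmAt
    (hG1 : ∀ j, G j 1 = coDressKBmAt (toSite r) Lc (KInvStep (d := 3) Lc j)) (hS1 : ∀ j, S j 1 = (Js0 j).S) (hW1 : ∀ j, Wt j 1 = (Js0 j).W)
    {C δ : ℝ} (hGinf : Decays (KPerfOf (d := 3) sf sm G 1) C δ) (hδ : 0 < δ)
    {Cs δs : ℝ} (hSinf : LocStencil (SPerfOf sf sm S 1) Cs δs) (hδs : 0 < δs)
    (hSt : ∀ (j : ℕ) (κ : Fin (3 + 1)) (u t : Fin (3 + 1) → ℤ), (Js0 j).S κ (u + (Lc : ℤ) • t) = shiftK (-((Lc : ℤ) • t)) ((Js0 j).S κ u))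
    (hWt : ∀ (j : ℕ) (μ : Fin (3 + 1)) (y : Fin (3 + 1) → ℤ) (ν : Fin (3 + 1)) (y' t : Fin (3 + 1) → ℤ),
      (Js0 j).W μ (y + t) ν (y' + t) = shiftK (-((Lc : ℤ) • t)) ((Js0 j).W μ y ν y'))
    (hWsymm : ∀ (j : ℕ) (μ : Fin (3 + 1)) (y : Fin (3 + 1) → ℤ) (ν : Fin (3 + 1)) (y' : Fin (3 + 1) → ℤ), (Js0 j).W μ y ν y' = (Js0 j).W ν y' μ y)
    (a b : Fin (3 + 1)) (t : Fin (3 + 1) → ℤ) :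
    TGenOf Lc (KPerfOf sf sm G 1) (KPerfOf sf sm G 1) (SPerfOf sf sm S 1) (WPerfOf sf sm Wt 1) a b t
      = TGenOf Lc (KPerfOf sf sm G 1) (KPerfOf sf sm G 1) (SPerfOf sf sm S 1) (WPerfOf sf sm Wt 1) b a (-t) :=
  hTsymm_TGenOf_one sf sm G G S Wt (A1 := fun j => coDressKBmAt (toSite r) Lc (KInvStep (d := 3) Lc j))
    (G1 := fun j => coDressKBmAt (toSite r) Lc (KInvStep (d := 3) Lc j)) (S1 := fun j => (Js0 j).S) (W1 := fun j => (Js0 j).W)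
    hG1 hG1 hS1 hW1 hGinf hδ ⟨δ, C, hδ, hGinf.nonneg (Sum.inl 0), hGinf⟩ hSinf hδs
    (fun j t => shiftK_coDressKBmAt_KInvStep (d := 3) (toSite r) j t) (fun j t => shiftK_coDressKBmAt_KInvStep (d := 3) (toSite r) j t)
    hSt hWt hWsymm a b t

end BlockMean

end Summit.QuantumFields.BalabanUV.Beta.FP.PerfectKernelSymmGeneric

end
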